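/-
Copyright (c) 2026 Harness contributors. All rights reserved.
Released under Apache 2.0 license as described in the file LICENSE.
-/
import Mathlib
import Literature.Analysis.ODE.SpectralBoundExponentialGrowth
import HarnessLib

/-!
# Exponential growth bounds for `e^{tA}`, `A` a REAL operator on `ℝⁿ`, from the complex roots of its
# characteristic polynomial (Khalil, *Nonlinear Systems*, §4.3 eq. (4.11))

Topic `Literature/Analysis/ODE` (namespace `Literature.Analysis.ODE`).  Everything is PROVED (no named
fact, no definition, no instance, no `sorry`).  `SpectralBoundExponentialGrowth.lean` bounds `‖e^{tT}‖`
for a COMPLEX-linear `T` by the real parts of its eigenvalues and transfers bounds to a real operator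
along any complexification `ι` with `ι ∘ A = T ∘ ι`.  This file supplies the CANONICAL
complexification of `ℝⁿ = EuclideanSpace ℝ n` — `ι v = (v₁, …, vₙ) ∈ ℂⁿ`, `T` = the complex matrix
of `A` acting on `EuclideanSpace ℂ n` — and identifies the eigenvalues of `T` with the complex roots of
the (real) characteristic polynomial of the standard matrix of `A`; whence Khalil's (4.11) in the form
users need:

* `exists_complexification` — `∃ ι T, ι ∘ A = T ∘ ι ∧ (HasEigenvalue T μ ↔ χ_A(μ) = 0)` where
  `χ_A = (LinearMap.toMatrix (std basis) A).charpoly` mapped to `ℂ[X]`;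
* `exists_norm_exp_smul_le_of_charpoly_roots_re_lt` — **every complex root `μ` of `χ_A` has
  `Re μ < β` ⇒ `‖e^{tA}‖ ≤ C e^{βt}` for `t ≥ 0`**;
* `exists_norm_exp_neg_smul_le_of_lt_charpoly_roots_re` — every root has `α < Re μ` ⇒
  `‖e^{−tA}‖ ≤ C e^{−αt}` for `t ≥ 0`.

Together: roots in a strip `α < Re μ < β` ⇒ the exponential dichotomy hypotheses of
`exists_adaptedCLM_of_expDichotomy` (`LyapunovAdaptedInnerProduct.lean`).

## Mathlib / tree search

Mathlib: `Matrix.toEuclideanCLM`, `Matrix.toEuclideanCLM_toLp`, `Matrix.coe_toEuclideanCLM_eq_toEuclideanLin`,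
`Matrix.toEuclideanLin_eq_toLin_orthonormal`, `LinearMap.toMatrix_toLin`, `LinearMap.toMatrix_mulVec_repr`,
`LinearMap.charpoly_toMatrix`, `Matrix.charpoly_map`, `Module.End.hasEigenvalue_iff_isRoot_charpoly`,
`RingHom.map_mulVec`, `EuclideanSpace.norm_eq` (used).  No complexification functor for real normed
spaces / `EuclideanSpace` in Mathlib or the tree (`lean search 'omplexif'`: only
`LinearMap.baseChange`-style algebra, no norms).

## References

* H. K. Khalil, *Nonlinear Systems*, 3rd ed., Prentice Hall 2002, §4.3 eq. (4.11), Theorem 4.5.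
  [Khalil2002]
-/

noncomputable section

open scoped Topology
open NormedSpace WithLp

namespace Literature.Analysis.ODE

variable {n : Type*} [Fintype n] [DecidableEq n]

/-- Coordinates of `A v` are the standard matrix of `A` times the coordinates of `v`. [folklore] -/
private theorem apply_coord_eq_mulVec (A : EuclideanSpace ℝ n →L[ℝ] EuclideanSpace ℝ n)
    (v : EuclideanSpace ℝ n) (i : n) :
    (A v) i = Matrix.mulVec (LinearMap.toMatrix (EuclideanSpace.basisFun n ℝ).toBasis
      (EuclideanSpace.basisFun n ℝ).toBasis (A : EuclideanSpace ℝ n →ₗ[ℝ] EuclideanSpace ℝ n))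
      (fun j => v j) i := by
  set b := (EuclideanSpace.basisFun n ℝ).toBasis with hb
  have h := LinearMap.toMatrix_mulVec_repr b b (A : _ →ₗ[ℝ] _) v
  have hr : ∀ w : EuclideanSpace ℝ n, ⇑(b.repr w) = fun j => w j := fun w =>
    funext fun j => by rw [hb, OrthonormalBasis.coe_toBasis_repr_apply]; rfl
  rw [hr, hr] at h
  exact (congrFun h i).symm

/-- **The canonical complexification of a real operator on `ℝⁿ`.**  For `A : ℝⁿ →L[ℝ] ℝⁿ` there are a
real-linear isometry `ι : ℝⁿ → ℂⁿ` (coordinatewise `x ↦ (x : ℂ)`) and a complex-linear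
`T : ℂⁿ →L[ℂ] ℂⁿ` (the matrix of `A` with complex entries) with `ι ∘ A = T ∘ ι`, and the eigenvalues
of `T` are exactly the complex roots of the characteristic polynomial of the standard matrix of `A`
(Khalil's passage from a real matrix to its complex Jordan form in (4.11)).
[cite: Khalil2002, §4.3 eq. (4.11)] -/
theorem exists_complexification (A : EuclideanSpace ℝ n →L[ℝ] EuclideanSpace ℝ n) :
    ∃ (ι : EuclideanSpace ℝ n →ₗᵢ[ℝ] EuclideanSpace ℂ n)
      (T : EuclideanSpace ℂ n →L[ℂ] EuclideanSpace ℂ n),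
      (∀ v, ι (A v) = T (ι v)) ∧
      ∀ μ : ℂ, Module.End.HasEigenvalue (T : EuclideanSpace ℂ n →ₗ[ℂ] EuclideanSpace ℂ n) μ ↔
        ((LinearMap.toMatrix (EuclideanSpace.basisFun n ℝ).toBasis (EuclideanSpace.basisFun n ℝ).toBasis
          (A : EuclideanSpace ℝ n →ₗ[ℝ] EuclideanSpace ℝ n)).charpoly.map (algebraMap ℝ ℂ)).IsRoot μ := by
  set M := LinearMap.toMatrix (EuclideanSpace.basisFun n ℝ).toBasis (EuclideanSpace.basisFun n ℝ).toBasis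
    (A : EuclideanSpace ℝ n →ₗ[ℝ] EuclideanSpace ℝ n) with hM
  -- the isometry `ι`
  let ιₗ : EuclideanSpace ℝ n →ₗ[ℝ] EuclideanSpace ℂ n :=
    { toFun := fun v => toLp 2 (fun i => ((v i : ℝ) : ℂ))
      map_add' := fun v w => by
        ext i
        show (((v + w) i : ℝ) : ℂ) = ((v i : ℝ) : ℂ) + ((w i : ℝ) : ℂ)
        rw [show (v + w) i = v i + w i from rfl, Complex.ofReal_add]
      map_smul' := fun c v => by
        ext i
        show (((c • v) i : ℝ) : ℂ) = c • ((v i : ℝ) : ℂ)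
        rw [show (c • v) i = c * v i from rfl, Complex.ofReal_mul, Complex.real_smul] }
  have hιₗ : ∀ v i, ιₗ v i = ((v i : ℝ) : ℂ) := fun v i => rfl
  have hnorm : ∀ v, ‖ιₗ v‖ = ‖v‖ := by
    intro v
    rw [EuclideanSpace.norm_eq, EuclideanSpace.norm_eq]
    congr 1
    exact Finset.sum_congr rfl fun i _ => by rw [hιₗ, Complex.norm_real]
  let ι : EuclideanSpace ℝ n →ₗᵢ[ℝ] EuclideanSpace ℂ n := ⟨ιₗ, hnorm⟩
  -- the complexified operator
  let T : EuclideanSpace ℂ n →L[ℂ] EuclideanSpace ℂ n :=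
    Matrix.toEuclideanCLM (n := n) (𝕜 := ℂ) (M.map (algebraMap ℝ ℂ))
  refine ⟨ι, T, fun v => ?_, fun μ => ?_⟩
  · -- intertwining, coordinatewise
    show ιₗ (A v) = T (toLp 2 (fun i => ((v i : ℝ) : ℂ)))
    rw [Matrix.toEuclideanCLM_toLp]
    ext i
    rw [hιₗ, apply_coord_eq_mulVec A v i, ← hM,
      show ((Matrix.mulVec M (fun j => v j) i : ℝ) : ℂ) = algebraMap ℝ ℂ (Matrix.mulVec M (fun j => v j) i)
        from rfl, RingHom.map_mulVec (algebraMap ℝ ℂ) M (fun j => v j) i]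
    rfl
  · -- spectrum = complex roots of the real characteristic polynomial
    rw [Module.End.hasEigenvalue_iff_isRoot_charpoly,
      ← LinearMap.charpoly_toMatrix _ (EuclideanSpace.basisFun n ℂ).toBasis]
    have hT : LinearMap.toMatrix (EuclideanSpace.basisFun n ℂ).toBasis (EuclideanSpace.basisFun n ℂ).toBasis
        (T : EuclideanSpace ℂ n →ₗ[ℂ] EuclideanSpace ℂ n) = M.map (algebraMap ℝ ℂ) := by
      rw [Matrix.coe_toEuclideanCLM_eq_toEuclideanLin, Matrix.toEuclideanLin_eq_toLin_orthonormal,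
        LinearMap.toMatrix_toLin]
    rw [hT, Matrix.charpoly_map]

/-- **Real operators: spectral bound ⇒ exponential growth bound** (Khalil (4.11) / Theorem 4.5): if
every complex root `μ` of the characteristic polynomial of (the standard matrix of) `A : ℝⁿ →L[ℝ] ℝⁿ`
has `Re μ < β`, then `‖e^{tA}‖ ≤ C e^{βt}` for `t ≥ 0`.
[cite: Khalil2002, §4.3 eq. (4.11) and Theorem 4.5] -/
theorem exists_norm_exp_smul_le_of_charpoly_roots_re_lt
    (A : EuclideanSpace ℝ n →L[ℝ] EuclideanSpace ℝ n) {β : ℝ}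
    (hβ : ∀ μ : ℂ, ((LinearMap.toMatrix (EuclideanSpace.basisFun n ℝ).toBasis
      (EuclideanSpace.basisFun n ℝ).toBasis (A : EuclideanSpace ℝ n →ₗ[ℝ] EuclideanSpace ℝ n)).charpoly.map
        (algebraMap ℝ ℂ)).IsRoot μ → μ.re < β) :
    ∃ C : ℝ, ∀ t : ℝ, 0 ≤ t → ‖exp (t • A)‖ ≤ C * Real.exp (β * t) := by
  obtain ⟨ι, T, hι, hspec⟩ := exists_complexification A
  obtain ⟨C, hC⟩ := exists_norm_exp_smul_le_of_eigenvalues_re_lt T (β := β)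
    fun μ hμ => hβ μ ((hspec μ).1 hμ)
  exact ⟨C, fun t ht => (norm_exp_smul_le_of_semiconj ι A T hι t).2.trans (hC t ht)⟩

/-- **Real operators: lower spectral bound ⇒ decay of `e^{−tA}`**: if every complex root `μ` of the
characteristic polynomial of `A` has `α < Re μ`, then `‖e^{−tA}‖ ≤ C e^{−αt}` for `t ≥ 0`.
[cite: Khalil2002, §4.3 eq. (4.11) and Theorem 4.5] -/
theorem exists_norm_exp_neg_smul_le_of_lt_charpoly_roots_re
    (A : EuclideanSpace ℝ n →L[ℝ] EuclideanSpace ℝ n) {α : ℝ}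
    (hα : ∀ μ : ℂ, ((LinearMap.toMatrix (EuclideanSpace.basisFun n ℝ).toBasis
      (EuclideanSpace.basisFun n ℝ).toBasis (A : EuclideanSpace ℝ n →ₗ[ℝ] EuclideanSpace ℝ n)).charpoly.map
        (algebraMap ℝ ℂ)).IsRoot μ → α < μ.re) :
    ∃ C : ℝ, ∀ t : ℝ, 0 ≤ t → ‖exp (-(t • A))‖ ≤ C * Real.exp (-α * t) := by
  obtain ⟨ι, T, hι, hspec⟩ := exists_complexification A
  obtain ⟨C, hC⟩ := exists_norm_exp_neg_smul_le_of_lt_eigenvalues_re T (α := α)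
    fun μ hμ => hα μ ((hspec μ).1 hμ)
  refine ⟨C, fun t ht => ?_⟩
  have h1 := (norm_exp_smul_le_of_semiconj ι A T hι (-t)).2
  have e1 : (-t) • A = -(t • A) := neg_smul t A
  have e2 : ((-t : ℝ) : ℂ) • T = -((t : ℂ) • T) := by rw [Complex.ofReal_neg]; exact neg_smul (t : ℂ) T
  rw [e1, e2] at h1
  exact h1.trans (hC t ht)

end Literature.Analysis.ODE
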